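import Summits.QuantumFields.BalabanUV.Beta.D1BFx.ChargeFreeEnvelopes
import Summits.QuantumFields.BalabanUV.Beta.D1BFx.DressedVertexSplit
import Summits.QuantumFields.BalabanUV.Beta.DshAn1Spread

/-!
# `BalabanUV.Beta.D1BFx.ColumnGaugeDefectEnvelope` — road «BF-x», binder row D1, PART 24 HEAD §4 (b) (OWNER d1-p2 g24 `PART24-HEAD-SPEC-g24.md` v1.1 §5 step 4: «currency
# named (leaf-01 O-2 `ColumnGaugeDefectEnvelope` = the `BiLoc` letter for (b))»): **THE DISPLAYED DEFECT WORDS OF A DIAGONAL GAUGE GENERATOR AGAINST A BOUNDED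
# FINITE-WINDOW KERNEL ARE BI-LOCALISED CONTACTS — `G^{D} = [diagK g, D]` has entries `(g x̃ − g z̃)·D x z a b`, `[diagK h, [diagK g, D]]` has entries
# `(h x̃ − h z̃)·(g x̃ − g z̃)·D x z a b`; priced EITHER by the oscillation of the weight across the window (gradient envelope, §2–§5) OR by the weight's own decaying
# envelope (§6, the route the record's instances `ColumnGaugeDefectRecord` take)**, generic in `D` (an1's `Dsh n`: `DshAn1Spread.abs_Dsh_le` ∕ `Dsh_ne_zero_window`) and in the
# weights (the road's `ξ·χ_{μ,y}∘legSite ρ`, `χ_{μ,y}` = block-mean gauge function of a column: `DressedVertexSplit.abs_bmGaugeAt_weight_le` ∕ `abs_grad_weight_le`)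

HONEST DEPENDENCY (cell records, verbatim): «continuum YM on T⁴ ⇐ BetaPertH ∧ nine spine estimates (0/9 proved); BetaPertH ⇐ (D1) ∧ (D4) ∧
CAP+tail; G-an2-4 gates asym, D1 and NE2/3/4.»  HONEST FRAMING (cell contract, verbatim): «discharging `BetaPertH` makes Bałaban's UV stability
UNCONDITIONAL — a real constructive-QFT result; it is NOT the continuum limit and NOT the Clay problem.»  THIS MODULE is [folklore] entrywise bookkeeping over an2's
`diagK` (`comp_diagK_left ∕ right`), an1's `legSite`, g30's telescoping `ChargeFreeEnvelopes.abs_sub_le_of_unitDiff_ball`; `D`, `χ`, `χ′` ARBITRARY (displayed: entry bound + finite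
window of `D`, envelopes of the weights).  No `def`, no `def … : Prop`, nothing cited, NO printed hypothesis, 0 sorry.  It prices NO (1.22) row by itself; 0 root-level binders of
row D1 discharged; (K) NOT closed; (J1) ONE OPEN ROW; NOT D1, NEVER «G-an2-4 closed», NOT `BetaPertH`, NOT continuum, NOT Clay.

ABSOLUTE RULE (cell charter, verbatim): «No internally-minted statement may enter as a cited fact. Every hypothesis is either kernel-proved in
this package or a verbatim quotation of a PUBLISHED theorem with page reference. The manuscript(s) under audit are NOT citable for their own
disputed steps — they are the thing under adjudication; programme-internal (2001/route/tribunal) claims are never citable.»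

CONTENT (dimension `d + 1`; `x̃ := legSite ρ x a`).
* §1 `commDefect_apply` ∕ `commCommDefect_apply` (entries).  §2 `abs_sub_le_of_gradEnvelope`: `|χ(w + e_κ) − χ w| ≤ Cg·e^{−δ|w − p|₁}` ⟹ `|χ q′ − χ q| ≤ Cg·e^{δR}·e^{−δ|q − p|₁}·|q′ − q|₁`
  for `|q′ − q|₁ ≤ R`.  §3 `abs_commDefect_le` (gain route, `R := (d+1)W + 2|ρ|₁`), §4 `abs_commCommDefect_le` (two oscillation factors), §5 `biLoc_commDefect` (at `(p,p)`, rate `δ∕2`),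
  `biLoc_commCommDefect` (at the PAIR `(p,p′)`, rate `δ`).
* §6 THE WEIGHT ROUTE (`|χ w| ≤ Cχ·e^{−δ|w − p|₁}`): `biLoc_commDefect_of_weight` (`BiLoc (G^{D}) p p (2·|ξ|·Cχ·e^{δ|ρ|₁}·B·e^{(δ∕2)(d+1)W}) (δ∕2)`), `biLoc_commCommDefect_of_weight` (pair `(p,p′)`, rate `δ`).
Unit `b2b-balaban-beta-d1-formalise-leaf-01` (gen 31 draft v0.3 §1–§5; gen 32 §6), D1 formalisation swarm LEAF PROVER 01, road «BF-x».  Not in print; our bookkeeping.  No existing file touched.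
-/

noncomputable section

namespace Summit.QuantumFields.BalabanUV.Beta.D1BFx.ColumnGaugeDefectEnvelope

open Literature.MathematicalPhysics.QuantumFieldTheory.Balaban1983to89
open Literature.MathematicalPhysics.QuantumFieldTheory.Balaban1983to89.Beta
open B12Sec2to5 (l1 l1_nonneg)
open ExpKernelCalculus (MKer BiLoc comp l1_sub_triangle l1_sub_symm)
open StepJetData (l1_add_le)
open OneStepKernelFamily (l1_neg_eq)
open AffineAveraging (Site unitVec)
open OneStepResolventKernel (Fib)
open Summit.QuantumFields.BalabanUV.Beta.BorderedHessian (diagK comp_diagK_left comp_diagK_right)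
open Summit.QuantumFields.BalabanUV.Beta.AveragingWardRootedStencils (legSite legSite_inl legSite_inr)
open Summit.QuantumFields.BalabanUV.Beta.AxialDressingRooted (cube l1_le_of_mem_cube)
open Summit.QuantumFields.BalabanUV.Beta.D1BFx.ChargeFreeEnvelopes (abs_sub_le_of_unitDiff_ball)

variable {d : ℕ}

/-! ## §1 Entries of the defect words -/

/-- [folklore] **ENTRIES OF THE FIRST DEFECT WORD** `G^{D} := diagK g∘D − D∘diagK g`: `(g x a − g z b)·D x z a b`. -/
theorem commDefect_apply (g : Site (d + 1) → Fib d → ℝ) (D : MKer (d + 1) (Fib d)) (x z : Site (d + 1)) (a b : Fib d) :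
    (comp (diagK g) D - comp D (diagK g)) x z a b = (g x a - g z b) * D x z a b := by
  rw [Pi.sub_apply, Pi.sub_apply, Pi.sub_apply, Pi.sub_apply, comp_diagK_left, comp_diagK_right]
  ring

/-- [folklore] **ENTRIES OF THE SECOND DEFECT WORD** `[diagK h, [diagK g, D]]`: `(h x a − h z b)·((g x a − g z b)·D x z a b)`. -/
theorem commCommDefect_apply (g h : Site (d + 1) → Fib d → ℝ) (D : MKer (d + 1) (Fib d)) (x z : Site (d + 1)) (a b : Fib d) :
    (comp (diagK h) (comp (diagK g) D - comp D (diagK g)) - comp (comp (diagK g) D - comp D (diagK g)) (diagK h)) x z a b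
      = (h x a - h z b) * ((g x a - g z b) * D x z a b) := by
  rw [Pi.sub_apply, Pi.sub_apply, Pi.sub_apply, Pi.sub_apply, comp_diagK_left, comp_diagK_right, commDefect_apply]
  ring

/-! ## §2 Oscillation of a weight with a decaying gradient envelope -/

/-- [folklore] **OSCILLATION FROM A DECAYING GRADIENT ENVELOPE**: if `|χ (w + e_κ) − χ w| ≤ Cg·e^{−δ|w − p|₁}` for all `κ, w` (`Cg, δ ≥ 0`), then for `|q′ − q|₁ ≤ R`,
`|χ q′ − χ q| ≤ Cg·e^{δR}·e^{−δ|q − p|₁}·|q′ − q|₁` (telescoping inside the `ℓ¹`-ball of radius `R` about `q`, where every unit difference is `≤ Cg·e^{δR}·e^{−δ|q − p|₁}`). -/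
theorem abs_sub_le_of_gradEnvelope {χ : Site (d + 1) → ℝ} {Cg δ : ℝ} {p : Site (d + 1)} (hCg : 0 ≤ Cg) (hδ : 0 ≤ δ)
    (hg : ∀ (κ : Fin (d + 1)) (w : Site (d + 1)), |χ (w + unitVec κ) - χ w| ≤ Cg * Real.exp (-δ * l1 (w - p))) {R : ℝ} (q q' : Site (d + 1))
    (hR : l1 (q' - q) ≤ R) : |χ q' - χ q| ≤ Cg * Real.exp (δ * R) * Real.exp (-δ * l1 (q - p)) * l1 (q' - q) := by
  refine abs_sub_le_of_unitDiff_ball (f := χ) (G := Cg * Real.exp (δ * R) * Real.exp (-δ * l1 (q - p))) (ρ := R) q (fun κ w hw _ => ?_) q' hR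
  refine (hg κ w).trans ?_
  rw [mul_assoc, ← Real.exp_add]
  refine mul_le_mul_of_nonneg_left (Real.exp_le_exp.2 ?_) hCg
  have t : l1 (q - p) ≤ l1 (q - w) + l1 (w - p) := l1_sub_triangle q w p
  rw [l1_sub_symm q w] at t
  nlinarith

/-! ## §3 The first defect word: one oscillation of `χ` across the window of `D` -/

/-- [folklore] The `ℓ¹`-distance of two leg sites of a finite-window entry: `x − z ∈ cube (d+1) W` ⟹ `|legSite ρ z b − legSite ρ x a|₁ ≤ (d+1)·W + 2·|ρ|₁`. -/
theorem l1_legSite_sub_legSite_le {W : ℕ} {x z : Site (d + 1)} (hxz : x - z ∈ cube (d + 1) W) (ρ : Site (d + 1)) (a b : Fib d) :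
    l1 (legSite ρ z b - legSite ρ x a) ≤ ((d : ℝ) + 1) * W + 2 * l1 ρ := by
  have hzx : l1 (z - x) ≤ ((d : ℝ) + 1) * W := by
    rw [l1_sub_symm z x]
    have h := l1_le_of_mem_cube hxz
    push_cast at h
    exact h
  have hρ := l1_nonneg ρ
  rcases a with α | m <;> rcases b with β | m'
  · simp only [legSite_inl]; linarith
  · simp only [legSite_inl, legSite_inr]
    calc l1 (z + ρ - x) = l1 ((z - x) + ρ) := by congr 1; abel
      _ ≤ l1 (z - x) + l1 ρ := l1_add_le _ _
      _ ≤ _ := by linarith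
  · simp only [legSite_inl, legSite_inr]
    calc l1 (z - (x + ρ)) = l1 ((z - x) + -ρ) := by congr 1; abel
      _ ≤ l1 (z - x) + l1 (-ρ) := l1_add_le _ _
      _ ≤ _ := by rw [l1_neg_eq]; linarith
  · simp only [legSite_inr]
    calc l1 (z + ρ - (x + ρ)) = l1 (z - x) := by congr 1; abel
      _ ≤ _ := by linarith

/-- [folklore] The leg site is within `|ρ|₁` of the kernel leg: `e^{−δ|legSite ρ x a − p|₁} ≤ e^{δ|ρ|₁}·e^{−δ|x − p|₁}` (`δ ≥ 0`). -/
theorem exp_legSite_le {δ : ℝ} (hδ : 0 ≤ δ) (ρ x p : Site (d + 1)) (a : Fib d) :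
    Real.exp (-δ * l1 (legSite ρ x a - p)) ≤ Real.exp (δ * l1 ρ) * Real.exp (-δ * l1 (x - p)) := by
  rw [← Real.exp_add]
  refine Real.exp_le_exp.2 ?_
  have t : l1 (x - p) ≤ l1 (x - legSite ρ x a) + l1 (legSite ρ x a - p) := l1_sub_triangle x (legSite ρ x a) p
  have hx : l1 (x - legSite ρ x a) ≤ l1 ρ := by
    rcases a with α | m
    · simp only [legSite_inl, sub_self]
      rw [BalabanCompositeJets.l1_zero']
      exact l1_nonneg ρ
    · simp only [legSite_inr]
      rw [show x - (x + ρ) = -ρ from by abel, l1_neg_eq]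
  nlinarith

/-- [folklore] **THE FIRST DEFECT WORD, ENTRYWISE**: for `|D x z a b| ≤ B`, `D x z a b = 0` unless `x − z ∈ cube (d+1) W`, a weight `χ` with gradient envelope `Cg·e^{−δ|· − p|₁}` and a lock `ξ`,
`|([diagK (ξ·χ∘legSite ρ), D]) x z a b| ≤ |ξ|·B·(Cg·e^{δR}·R)·e^{δ|ρ|₁}·e^{−δ|x − p|₁}`, `R := (d+1)·W + 2|ρ|₁` — ONE GAIN: the entry carries the OSCILLATION of `χ` across the window,
not `χ` itself. -/
theorem abs_commDefect_le {D : MKer (d + 1) (Fib d)} {B : ℝ} {W : ℕ} (hB : ∀ x z a b, |D x z a b| ≤ B) (hwin : ∀ x z a b, D x z a b ≠ 0 → x - z ∈ cube (d + 1) W)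
    {χ : Site (d + 1) → ℝ} {Cg δ : ℝ} {p : Site (d + 1)} (hCg : 0 ≤ Cg) (hδ : 0 ≤ δ)
    (hg : ∀ (κ : Fin (d + 1)) (w : Site (d + 1)), |χ (w + unitVec κ) - χ w| ≤ Cg * Real.exp (-δ * l1 (w - p))) (ρ : Site (d + 1)) (ξ : ℝ)
    (x z : Site (d + 1)) (a b : Fib d) :
    |(comp (diagK fun z b => ξ * χ (legSite ρ z b)) D - comp D (diagK fun z b => ξ * χ (legSite ρ z b))) x z a b|
      ≤ |ξ| * B * (Cg * Real.exp (δ * (((d : ℝ) + 1) * W + 2 * l1 ρ)) * (((d : ℝ) + 1) * W + 2 * l1 ρ)) * Real.exp (δ * l1 ρ)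
          * Real.exp (-δ * l1 (x - p)) := by
  have hBn : 0 ≤ B := (abs_nonneg _).trans (hB x z a b)
  rw [commDefect_apply]
  by_cases hD : D x z a b = 0
  · rw [hD, mul_zero, abs_zero]
    have : 0 ≤ ((d : ℝ) + 1) * W + 2 * l1 ρ := by have := l1_nonneg ρ; positivity
    positivity
  have hxz := hwin x z a b hD
  have hR := l1_legSite_sub_legSite_le hxz ρ a b
  have hosc := abs_sub_le_of_gradEnvelope hCg hδ hg (legSite ρ x a) (legSite ρ z b) hR
  have hleg := exp_legSite_le hδ ρ x p a
  rw [abs_mul, show ξ * χ (legSite ρ x a) - ξ * χ (legSite ρ z b) = ξ * (χ (legSite ρ x a) - χ (legSite ρ z b)) from by ring, abs_mul,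
    abs_sub_comm (χ (legSite ρ x a))]
  have hRnn : 0 ≤ ((d : ℝ) + 1) * W + 2 * l1 ρ := by have := l1_nonneg ρ; positivity
  calc |ξ| * |χ (legSite ρ z b) - χ (legSite ρ x a)| * |D x z a b|
      ≤ |ξ| * (Cg * Real.exp (δ * (((d : ℝ) + 1) * W + 2 * l1 ρ)) * Real.exp (-δ * l1 (legSite ρ x a - p)) * (((d : ℝ) + 1) * W + 2 * l1 ρ)) * B := by
        refine mul_le_mul (mul_le_mul_of_nonneg_left (hosc.trans ?_) (abs_nonneg _)) (hB x z a b) (abs_nonneg _) (by positivity)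
        exact mul_le_mul_of_nonneg_left hR (by positivity)
    _ ≤ |ξ| * (Cg * Real.exp (δ * (((d : ℝ) + 1) * W + 2 * l1 ρ)) * (Real.exp (δ * l1 ρ) * Real.exp (-δ * l1 (x - p))) * (((d : ℝ) + 1) * W + 2 * l1 ρ)) * B := by
        gcongr
    _ = _ := by ring

/-! ## §4 The second defect word: two oscillations, two gains -/

/-- [folklore] The oscillation factor of a locked weight across a finite-window entry: `x − z ∈ cube (d+1) W` ⟹
`|ξ·χ(legSite ρ x a) − ξ·χ(legSite ρ z b)| ≤ |ξ|·(Cg·e^{δR}·R)·e^{δ|ρ|₁}·e^{−δ|x − p|₁}`, `R := (d+1)·W + 2|ρ|₁`. -/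
theorem abs_lockedOsc_le {W : ℕ} {x z : Site (d + 1)} (hxz : x - z ∈ cube (d + 1) W) {χ : Site (d + 1) → ℝ} {Cg δ : ℝ} {p : Site (d + 1)} (hCg : 0 ≤ Cg) (hδ : 0 ≤ δ)
    (hg : ∀ (κ : Fin (d + 1)) (w : Site (d + 1)), |χ (w + unitVec κ) - χ w| ≤ Cg * Real.exp (-δ * l1 (w - p))) (ρ : Site (d + 1)) (ξ : ℝ) (a b : Fib d) :
    |ξ * χ (legSite ρ x a) - ξ * χ (legSite ρ z b)|
      ≤ |ξ| * (Cg * Real.exp (δ * (((d : ℝ) + 1) * W + 2 * l1 ρ)) * (((d : ℝ) + 1) * W + 2 * l1 ρ)) * Real.exp (δ * l1 ρ) * Real.exp (-δ * l1 (x - p)) := by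
  have hR := l1_legSite_sub_legSite_le hxz ρ a b
  have hosc := abs_sub_le_of_gradEnvelope hCg hδ hg (legSite ρ x a) (legSite ρ z b) hR
  have hleg := exp_legSite_le hδ ρ x p a
  have hRnn : 0 ≤ ((d : ℝ) + 1) * W + 2 * l1 ρ := by have := l1_nonneg ρ; positivity
  rw [← mul_sub, abs_mul, abs_sub_comm]
  calc |ξ| * |χ (legSite ρ z b) - χ (legSite ρ x a)|
      ≤ |ξ| * (Cg * Real.exp (δ * (((d : ℝ) + 1) * W + 2 * l1 ρ)) * Real.exp (-δ * l1 (legSite ρ x a - p)) * (((d : ℝ) + 1) * W + 2 * l1 ρ)) :=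
        mul_le_mul_of_nonneg_left (hosc.trans (mul_le_mul_of_nonneg_left hR (by positivity))) (abs_nonneg _)
    _ ≤ |ξ| * (Cg * Real.exp (δ * (((d : ℝ) + 1) * W + 2 * l1 ρ)) * (Real.exp (δ * l1 ρ) * Real.exp (-δ * l1 (x - p))) * (((d : ℝ) + 1) * W + 2 * l1 ρ)) := by
        gcongr
    _ = _ := by ring

/-- [folklore] **THE SECOND DEFECT WORD, ENTRYWISE — TWO GAINS**: with `χ` (gradient envelope from `p`, lock `ξ`) and `χ′` (from `p′`, lock `ξ′`), finite-window bounded `D`: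
`|([diagK (ξ′·χ′∘legSite ρ), [diagK (ξ·χ∘legSite ρ), D]]) x z a b| ≤ (|ξ′|·(Cg′·e^{δR}·R)·e^{δ|ρ|₁}·e^{−δ|x − p′|₁})·(|ξ|·B·(Cg·e^{δR}·R)·e^{δ|ρ|₁}·e^{−δ|x − p|₁})` — each generator
contributes the OSCILLATION of its weight across the window (the HEAD's `W^{Dsh} μ y ν y′ = −[Λc ν y′, [Λc μ y, ξ•Dsh]]`: centres `p = N•y`, `p′ = N•y′`). -/
theorem abs_commCommDefect_le {D : MKer (d + 1) (Fib d)} {B : ℝ} {W : ℕ} (hB : ∀ x z a b, |D x z a b| ≤ B) (hwin : ∀ x z a b, D x z a b ≠ 0 → x - z ∈ cube (d + 1) W)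
    {χ χ' : Site (d + 1) → ℝ} {Cg Cg' δ : ℝ} {p p' : Site (d + 1)} (hCg : 0 ≤ Cg) (hCg' : 0 ≤ Cg') (hδ : 0 ≤ δ)
    (hg : ∀ (κ : Fin (d + 1)) (w : Site (d + 1)), |χ (w + unitVec κ) - χ w| ≤ Cg * Real.exp (-δ * l1 (w - p)))
    (hg' : ∀ (κ : Fin (d + 1)) (w : Site (d + 1)), |χ' (w + unitVec κ) - χ' w| ≤ Cg' * Real.exp (-δ * l1 (w - p'))) (ρ : Site (d + 1)) (ξ ξ' : ℝ)
    (x z : Site (d + 1)) (a b : Fib d) :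
    |(comp (diagK fun z b => ξ' * χ' (legSite ρ z b))
          (comp (diagK fun z b => ξ * χ (legSite ρ z b)) D - comp D (diagK fun z b => ξ * χ (legSite ρ z b)))
        - comp (comp (diagK fun z b => ξ * χ (legSite ρ z b)) D - comp D (diagK fun z b => ξ * χ (legSite ρ z b)))
          (diagK fun z b => ξ' * χ' (legSite ρ z b))) x z a b|
      ≤ (|ξ'| * (Cg' * Real.exp (δ * (((d : ℝ) + 1) * W + 2 * l1 ρ)) * (((d : ℝ) + 1) * W + 2 * l1 ρ)) * Real.exp (δ * l1 ρ) * Real.exp (-δ * l1 (x - p')))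
        * (|ξ| * B * (Cg * Real.exp (δ * (((d : ℝ) + 1) * W + 2 * l1 ρ)) * (((d : ℝ) + 1) * W + 2 * l1 ρ)) * Real.exp (δ * l1 ρ)
            * Real.exp (-δ * l1 (x - p))) := by
  have hBn : 0 ≤ B := (abs_nonneg _).trans (hB x z a b)
  have hRnn : 0 ≤ ((d : ℝ) + 1) * W + 2 * l1 ρ := by have := l1_nonneg ρ; positivity
  have h3 := abs_commDefect_le hB hwin hCg hδ hg ρ ξ x z a b
  rw [commDefect_apply] at h3
  rw [commCommDefect_apply, abs_mul]
  by_cases hD : D x z a b = 0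
  · rw [hD, mul_zero, abs_zero, mul_zero]
    positivity
  have hxz := hwin x z a b hD
  exact mul_le_mul (abs_lockedOsc_le hxz hCg' hδ hg' ρ ξ' a b) h3 (abs_nonneg _) (by positivity)

/-! ## §5 The `BiLoc` form of the first defect word (the `Loc` socket of `hessKer_columnGauge` ∕ an5's trace bounds) -/

/-- [folklore] **THE FIRST DEFECT WORD IS BI-LOCALISED AT `(p, p)`** (rate `δ∕2`; the window costs one factor `e^{(δ∕2)(d+1)W}`): under §3's hypotheses,
`BiLoc ([diagK (ξ·χ∘legSite ρ), D]) p p (|ξ|·B·(Cg·e^{δR}·R)·e^{δ|ρ|₁}·e^{(δ∕2)(d+1)W}) (δ∕2)`. -/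
theorem biLoc_commDefect {D : MKer (d + 1) (Fib d)} {B : ℝ} {W : ℕ} (hB : ∀ x z a b, |D x z a b| ≤ B) (hwin : ∀ x z a b, D x z a b ≠ 0 → x - z ∈ cube (d + 1) W)
    {χ : Site (d + 1) → ℝ} {Cg δ : ℝ} {p : Site (d + 1)} (hCg : 0 ≤ Cg) (hδ : 0 ≤ δ)
    (hg : ∀ (κ : Fin (d + 1)) (w : Site (d + 1)), |χ (w + unitVec κ) - χ w| ≤ Cg * Real.exp (-δ * l1 (w - p))) (ρ : Site (d + 1)) (ξ : ℝ) :
    BiLoc (comp (diagK fun z b => ξ * χ (legSite ρ z b)) D - comp D (diagK fun z b => ξ * χ (legSite ρ z b))) p p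
      (|ξ| * B * (Cg * Real.exp (δ * (((d : ℝ) + 1) * W + 2 * l1 ρ)) * (((d : ℝ) + 1) * W + 2 * l1 ρ)) * Real.exp (δ * l1 ρ)
        * Real.exp (δ / 2 * (((d : ℝ) + 1) * W))) (δ / 2) := by
  intro x z a b
  have hBn : 0 ≤ B := (abs_nonneg _).trans (hB x z a b)
  have hRnn : 0 ≤ ((d : ℝ) + 1) * W + 2 * l1 ρ := by have := l1_nonneg ρ; positivity
  by_cases hD : D x z a b = 0
  · rw [commDefect_apply, hD, mul_zero, abs_zero]
    positivity
  have hxz := hwin x z a b hD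
  have hzx : l1 (x - z) ≤ ((d : ℝ) + 1) * W := by
    have h := l1_le_of_mem_cube hxz
    push_cast at h
    exact h
  refine (abs_commDefect_le hB hwin hCg hδ hg ρ ξ x z a b).trans ?_
  rw [mul_assoc (|ξ| * B * (Cg * Real.exp (δ * (((d : ℝ) + 1) * W + 2 * l1 ρ)) * (((d : ℝ) + 1) * W + 2 * l1 ρ)) * Real.exp (δ * l1 ρ)),
    ← Real.exp_add]
  refine mul_le_mul_of_nonneg_left (Real.exp_le_exp.2 ?_) (by positivity)
  have t : l1 (z - p) ≤ l1 (z - x) + l1 (x - p) := l1_sub_triangle z x p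
  rw [l1_sub_symm z x] at t
  nlinarith [l1_nonneg (x - p), l1_nonneg (z - p)]

/-- [folklore] **THE SECOND DEFECT WORD IS BI-LOCALISED AT THE PAIR `(p, p′)`** (full rate `δ` on each leg; the window costs `e^{δ(d+1)W}`): under §4's hypotheses,
`BiLoc ([diagK (ξ′·χ′∘legSite ρ), [diagK (ξ·χ∘legSite ρ), D]]) p p′ ((|ξ′|·(Cg′·e^{δR}·R)·e^{δ|ρ|₁}·e^{δ(d+1)W})·(|ξ|·B·(Cg·e^{δR}·R)·e^{δ|ρ|₁})) δ` — a CONTACT in the bond pair. -/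
theorem biLoc_commCommDefect {D : MKer (d + 1) (Fib d)} {B : ℝ} {W : ℕ} (hB : ∀ x z a b, |D x z a b| ≤ B) (hwin : ∀ x z a b, D x z a b ≠ 0 → x - z ∈ cube (d + 1) W)
    {χ χ' : Site (d + 1) → ℝ} {Cg Cg' δ : ℝ} {p p' : Site (d + 1)} (hCg : 0 ≤ Cg) (hCg' : 0 ≤ Cg') (hδ : 0 ≤ δ)
    (hg : ∀ (κ : Fin (d + 1)) (w : Site (d + 1)), |χ (w + unitVec κ) - χ w| ≤ Cg * Real.exp (-δ * l1 (w - p)))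
    (hg' : ∀ (κ : Fin (d + 1)) (w : Site (d + 1)), |χ' (w + unitVec κ) - χ' w| ≤ Cg' * Real.exp (-δ * l1 (w - p'))) (ρ : Site (d + 1)) (ξ ξ' : ℝ) :
    BiLoc (comp (diagK fun z b => ξ' * χ' (legSite ρ z b))
          (comp (diagK fun z b => ξ * χ (legSite ρ z b)) D - comp D (diagK fun z b => ξ * χ (legSite ρ z b)))
        - comp (comp (diagK fun z b => ξ * χ (legSite ρ z b)) D - comp D (diagK fun z b => ξ * χ (legSite ρ z b)))
          (diagK fun z b => ξ' * χ' (legSite ρ z b))) p p'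
      ((|ξ'| * (Cg' * Real.exp (δ * (((d : ℝ) + 1) * W + 2 * l1 ρ)) * (((d : ℝ) + 1) * W + 2 * l1 ρ)) * Real.exp (δ * l1 ρ)
          * Real.exp (δ * (((d : ℝ) + 1) * W)))
        * (|ξ| * B * (Cg * Real.exp (δ * (((d : ℝ) + 1) * W + 2 * l1 ρ)) * (((d : ℝ) + 1) * W + 2 * l1 ρ)) * Real.exp (δ * l1 ρ))) δ := by
  intro x z a b
  have hBn : 0 ≤ B := (abs_nonneg _).trans (hB x z a b)
  have hRnn : 0 ≤ ((d : ℝ) + 1) * W + 2 * l1 ρ := by have := l1_nonneg ρ; positivity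
  by_cases hD : D x z a b = 0
  · rw [commCommDefect_apply, hD, mul_zero, mul_zero, abs_zero]
    positivity
  have hxz := hwin x z a b hD
  have hzx : l1 (x - z) ≤ ((d : ℝ) + 1) * W := by
    have h := l1_le_of_mem_cube hxz
    push_cast at h
    exact h
  refine (abs_commCommDefect_le hB hwin hCg hCg' hδ hg hg' ρ ξ ξ' x z a b).trans ?_
  -- `e^{−δ|x − p′|}·e^{−δ|x − p|} ≤ e^{δ(d+1)W}·e^{−δ(|x − p| + |z − p′|)}`
  have t : l1 (z - p') ≤ l1 (z - x) + l1 (x - p') := l1_sub_triangle z x p'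
  rw [l1_sub_symm z x] at t
  have key : Real.exp (-δ * l1 (x - p')) * Real.exp (-δ * l1 (x - p)) ≤ Real.exp (δ * (((d : ℝ) + 1) * W)) * Real.exp (-δ * (l1 (x - p) + l1 (z - p'))) := by
    rw [← Real.exp_add, ← Real.exp_add]
    exact Real.exp_le_exp.2 (by nlinarith [l1_nonneg (x - p), l1_nonneg (z - p')])
  set A : ℝ := |ξ'| * (Cg' * Real.exp (δ * (((d : ℝ) + 1) * W + 2 * l1 ρ)) * (((d : ℝ) + 1) * W + 2 * l1 ρ)) * Real.exp (δ * l1 ρ) with hA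
  set A' : ℝ := |ξ| * B * (Cg * Real.exp (δ * (((d : ℝ) + 1) * W + 2 * l1 ρ)) * (((d : ℝ) + 1) * W + 2 * l1 ρ)) * Real.exp (δ * l1 ρ) with hA'
  have hA0 : 0 ≤ A := by rw [hA]; positivity
  have hA0' : 0 ≤ A' := by rw [hA']; positivity
  calc A * Real.exp (-δ * l1 (x - p')) * (A' * Real.exp (-δ * l1 (x - p)))
      = A * A' * (Real.exp (-δ * l1 (x - p')) * Real.exp (-δ * l1 (x - p))) := by ring
    _ ≤ A * A' * (Real.exp (δ * (((d : ℝ) + 1) * W)) * Real.exp (-δ * (l1 (x - p) + l1 (z - p')))) :=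
        mul_le_mul_of_nonneg_left key (mul_nonneg hA0 hA0')
    _ = _ := by ring

/-! ## §6 The weight route (no oscillation): a DECAYING weight against a bounded finite-window kernel (the record's `ξ·χ = (n⁴∕2)·bmGaugeAt …` is itself `O(1)` and
`ℓ¹`-decaying, while g29's crude gradient envelope has the weight's own size, so across an1's `2n`-window the gain route of §3–§5 LOSES a power of `n`; §3–§5 serve a
pricing author holding a sharper gradient letter, e.g. `AxialRibbon`'s interior one) -/

/-- [folklore] A decaying weight read at a leg site: `|χ (legSite ρ x a)| ≤ Cχ·e^{δ|ρ|₁}·e^{−δ|x − p|₁}` (`Cχ, δ ≥ 0`). -/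
theorem abs_weight_legSite_le {χ : Site (d + 1) → ℝ} {Cχ δ : ℝ} {p : Site (d + 1)} (hCχ : 0 ≤ Cχ) (hδ : 0 ≤ δ)
    (hχ : ∀ w, |χ w| ≤ Cχ * Real.exp (-δ * l1 (w - p))) (ρ x : Site (d + 1)) (a : Fib d) :
    |χ (legSite ρ x a)| ≤ Cχ * Real.exp (δ * l1 ρ) * Real.exp (-δ * l1 (x - p)) :=
  (hχ _).trans (by rw [mul_assoc]; exact mul_le_mul_of_nonneg_left (exp_legSite_le hδ ρ x p a) hCχ)

/-- [folklore] **THE FIRST DEFECT WORD BY THE WEIGHT'S OWN ENVELOPE** (no oscillation): for `|D x z a b| ≤ B`, a weight with `|χ w| ≤ Cχ·e^{−δ|w − p|₁}`, lock `ξ`, legs root `ρ`: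
`|([diagK (ξ·χ∘legSite ρ), D]) x z a b| ≤ |ξ|·(Cχ·e^{δ|ρ|₁})·B·(e^{−δ|x − p|₁} + e^{−δ|z − p|₁})`. -/
theorem abs_commDefect_le_of_weight {D : MKer (d + 1) (Fib d)} {B : ℝ} (hB : ∀ x z a b, |D x z a b| ≤ B)
    {χ : Site (d + 1) → ℝ} {Cχ δ : ℝ} {p : Site (d + 1)} (hCχ : 0 ≤ Cχ) (hδ : 0 ≤ δ) (hχ : ∀ w, |χ w| ≤ Cχ * Real.exp (-δ * l1 (w - p)))
    (ρ : Site (d + 1)) (ξ : ℝ) (x z : Site (d + 1)) (a b : Fib d) :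
    |(comp (diagK fun z b => ξ * χ (legSite ρ z b)) D - comp D (diagK fun z b => ξ * χ (legSite ρ z b))) x z a b|
      ≤ |ξ| * (Cχ * Real.exp (δ * l1 ρ)) * B * (Real.exp (-δ * l1 (x - p)) + Real.exp (-δ * l1 (z - p))) := by
  have hBn : 0 ≤ B := (abs_nonneg _).trans (hB x z a b)
  rw [commDefect_apply, ← mul_sub, abs_mul, abs_mul]
  have hsub : |χ (legSite ρ x a) - χ (legSite ρ z b)| ≤ Cχ * Real.exp (δ * l1 ρ) * (Real.exp (-δ * l1 (x - p)) + Real.exp (-δ * l1 (z - p))) := by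
    refine (abs_sub _ _).trans ?_
    rw [mul_add]
    exact add_le_add (abs_weight_legSite_le hCχ hδ hχ ρ x a) (abs_weight_legSite_le hCχ hδ hχ ρ z b)
  calc |ξ| * |χ (legSite ρ x a) - χ (legSite ρ z b)| * |D x z a b|
      ≤ |ξ| * (Cχ * Real.exp (δ * l1 ρ) * (Real.exp (-δ * l1 (x - p)) + Real.exp (-δ * l1 (z - p)))) * B :=
        mul_le_mul (mul_le_mul_of_nonneg_left hsub (abs_nonneg _)) (hB x z a b) (abs_nonneg _) (by positivity)
    _ = _ := by ring

/-- [folklore] **THE FIRST DEFECT WORD IS BI-LOCALISED AT `(p, p)` BY THE WEIGHT ROUTE** (rate `δ∕2`; the finite window `cube (d+1) W` of `D` costs `e^{(δ∕2)(d+1)W}`):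
`BiLoc ([diagK (ξ·χ∘legSite ρ), D]) p p (2·(|ξ|·(Cχ·e^{δ|ρ|₁})·B)·e^{(δ∕2)(d+1)W}) (δ∕2)`. -/
theorem biLoc_commDefect_of_weight {D : MKer (d + 1) (Fib d)} {B : ℝ} {W : ℕ} (hB : ∀ x z a b, |D x z a b| ≤ B)
    (hwin : ∀ x z a b, D x z a b ≠ 0 → x - z ∈ cube (d + 1) W) {χ : Site (d + 1) → ℝ} {Cχ δ : ℝ} {p : Site (d + 1)} (hCχ : 0 ≤ Cχ) (hδ : 0 ≤ δ)
    (hχ : ∀ w, |χ w| ≤ Cχ * Real.exp (-δ * l1 (w - p))) (ρ : Site (d + 1)) (ξ : ℝ) :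
    BiLoc (comp (diagK fun z b => ξ * χ (legSite ρ z b)) D - comp D (diagK fun z b => ξ * χ (legSite ρ z b))) p p
      (2 * (|ξ| * (Cχ * Real.exp (δ * l1 ρ)) * B) * Real.exp (δ / 2 * (((d : ℝ) + 1) * W))) (δ / 2) := by
  intro x z a b
  have hBn : 0 ≤ B := (abs_nonneg _).trans (hB x z a b)
  by_cases hD : D x z a b = 0
  · rw [commDefect_apply, hD, mul_zero, abs_zero]
    positivity
  have hxz : l1 (x - z) ≤ ((d : ℝ) + 1) * W := by have h := l1_le_of_mem_cube (hwin x z a b hD); push_cast at h; exact h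
  refine (abs_commDefect_le_of_weight hB hCχ hδ hχ ρ ξ x z a b).trans ?_
  have t1 : l1 (z - p) ≤ l1 (z - x) + l1 (x - p) := l1_sub_triangle z x p
  have t2 : l1 (x - p) ≤ l1 (x - z) + l1 (z - p) := l1_sub_triangle x z p
  rw [l1_sub_symm z x] at t1
  have k1 : δ * l1 (z - p) ≤ δ * l1 (x - z) + δ * l1 (x - p) := by nlinarith [l1_nonneg (x - z)]
  have k2 : δ * l1 (x - p) ≤ δ * l1 (x - z) + δ * l1 (z - p) := by nlinarith [l1_nonneg (x - z)]
  have k3 : δ * l1 (x - z) ≤ δ * (((d : ℝ) + 1) * W) := mul_le_mul_of_nonneg_left hxz hδ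
  have e1 : Real.exp (-δ * l1 (x - p)) ≤ Real.exp (δ / 2 * (((d : ℝ) + 1) * W)) * Real.exp (-(δ / 2) * (l1 (x - p) + l1 (z - p))) := by
    rw [← Real.exp_add]; exact Real.exp_le_exp.2 (by linarith)
  have e2 : Real.exp (-δ * l1 (z - p)) ≤ Real.exp (δ / 2 * (((d : ℝ) + 1) * W)) * Real.exp (-(δ / 2) * (l1 (x - p) + l1 (z - p))) := by
    rw [← Real.exp_add]; exact Real.exp_le_exp.2 (by linarith)
  have hA : 0 ≤ |ξ| * (Cχ * Real.exp (δ * l1 ρ)) * B := by positivity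
  calc |ξ| * (Cχ * Real.exp (δ * l1 ρ)) * B * (Real.exp (-δ * l1 (x - p)) + Real.exp (-δ * l1 (z - p)))
      ≤ |ξ| * (Cχ * Real.exp (δ * l1 ρ)) * B
          * (2 * (Real.exp (δ / 2 * (((d : ℝ) + 1) * W)) * Real.exp (-(δ / 2) * (l1 (x - p) + l1 (z - p))))) :=
        mul_le_mul_of_nonneg_left (by linarith) hA
    _ = _ := by ring

/-- [folklore] **THE SECOND DEFECT WORD BY THE WEIGHT ROUTE, ENTRYWISE**: weights `χ` (envelope from `p`, lock `ξ`) and `χ′` (from `p′`, lock `ξ′`), `|D| ≤ B`: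
`|([diagK (ξ′·χ′∘legSite ρ), [diagK (ξ·χ∘legSite ρ), D]]) x z a b| ≤ (|ξ′|·(Cχ′·e^{δ|ρ|₁})·(e^{−δ|x − p′|₁} + e^{−δ|z − p′|₁}))·(|ξ|·(Cχ·e^{δ|ρ|₁})·B·(e^{−δ|x − p|₁} + e^{−δ|z − p|₁}))`. -/
theorem abs_commCommDefect_le_of_weight {D : MKer (d + 1) (Fib d)} {B : ℝ} (hB : ∀ x z a b, |D x z a b| ≤ B)
    {χ χ' : Site (d + 1) → ℝ} {Cχ Cχ' δ : ℝ} {p p' : Site (d + 1)} (hCχ : 0 ≤ Cχ) (hCχ' : 0 ≤ Cχ') (hδ : 0 ≤ δ)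
    (hχ : ∀ w, |χ w| ≤ Cχ * Real.exp (-δ * l1 (w - p))) (hχ' : ∀ w, |χ' w| ≤ Cχ' * Real.exp (-δ * l1 (w - p'))) (ρ : Site (d + 1)) (ξ ξ' : ℝ)
    (x z : Site (d + 1)) (a b : Fib d) :
    |(comp (diagK fun z b => ξ' * χ' (legSite ρ z b))
          (comp (diagK fun z b => ξ * χ (legSite ρ z b)) D - comp D (diagK fun z b => ξ * χ (legSite ρ z b)))
        - comp (comp (diagK fun z b => ξ * χ (legSite ρ z b)) D - comp D (diagK fun z b => ξ * χ (legSite ρ z b)))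
          (diagK fun z b => ξ' * χ' (legSite ρ z b))) x z a b|
      ≤ (|ξ'| * (Cχ' * Real.exp (δ * l1 ρ)) * (Real.exp (-δ * l1 (x - p')) + Real.exp (-δ * l1 (z - p'))))
        * (|ξ| * (Cχ * Real.exp (δ * l1 ρ)) * B * (Real.exp (-δ * l1 (x - p)) + Real.exp (-δ * l1 (z - p)))) := by
  have hBn : 0 ≤ B := (abs_nonneg _).trans (hB x z a b)
  have h3 := abs_commDefect_le_of_weight hB hCχ hδ hχ ρ ξ x z a b
  rw [commDefect_apply] at h3
  rw [commCommDefect_apply, abs_mul]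
  refine mul_le_mul ?_ h3 (abs_nonneg _) (by positivity)
  rw [← mul_sub, abs_mul]
  have hsub : |χ' (legSite ρ x a) - χ' (legSite ρ z b)| ≤ Cχ' * Real.exp (δ * l1 ρ) * (Real.exp (-δ * l1 (x - p')) + Real.exp (-δ * l1 (z - p'))) := by
    refine (abs_sub _ _).trans ?_
    rw [mul_add]
    exact add_le_add (abs_weight_legSite_le hCχ' hδ hχ' ρ x a) (abs_weight_legSite_le hCχ' hδ hχ' ρ z b)
  exact (mul_le_mul_of_nonneg_left hsub (abs_nonneg ξ')).trans (le_of_eq (by ring))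

/-- [folklore] **THE SECOND DEFECT WORD IS A CONTACT IN THE BOND PAIR `(p, p′)` BY THE WEIGHT ROUTE** (full rate `δ`; the window `cube (d+1) W` of `D` costs `(1 + e^{δ(d+1)W})²`):
`BiLoc ([diagK (ξ′·χ′∘legSite ρ), [diagK (ξ·χ∘legSite ρ), D]]) p p′ ((|ξ′|·(Cχ′·e^{δ|ρ|₁}))·(|ξ|·(Cχ·e^{δ|ρ|₁})·B)·(1 + e^{δ(d+1)W})²) δ`. -/
theorem biLoc_commCommDefect_of_weight {D : MKer (d + 1) (Fib d)} {B : ℝ} {W : ℕ} (hB : ∀ x z a b, |D x z a b| ≤ B)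
    (hwin : ∀ x z a b, D x z a b ≠ 0 → x - z ∈ cube (d + 1) W) {χ χ' : Site (d + 1) → ℝ} {Cχ Cχ' δ : ℝ} {p p' : Site (d + 1)} (hCχ : 0 ≤ Cχ)
    (hCχ' : 0 ≤ Cχ') (hδ : 0 ≤ δ) (hχ : ∀ w, |χ w| ≤ Cχ * Real.exp (-δ * l1 (w - p))) (hχ' : ∀ w, |χ' w| ≤ Cχ' * Real.exp (-δ * l1 (w - p')))
    (ρ : Site (d + 1)) (ξ ξ' : ℝ) :
    BiLoc (comp (diagK fun z b => ξ' * χ' (legSite ρ z b))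
          (comp (diagK fun z b => ξ * χ (legSite ρ z b)) D - comp D (diagK fun z b => ξ * χ (legSite ρ z b)))
        - comp (comp (diagK fun z b => ξ * χ (legSite ρ z b)) D - comp D (diagK fun z b => ξ * χ (legSite ρ z b)))
          (diagK fun z b => ξ' * χ' (legSite ρ z b))) p p'
      ((|ξ'| * (Cχ' * Real.exp (δ * l1 ρ))) * (|ξ| * (Cχ * Real.exp (δ * l1 ρ)) * B) * (1 + Real.exp (δ * (((d : ℝ) + 1) * W))) ^ 2) δ := by
  intro x z a b
  have hBn : 0 ≤ B := (abs_nonneg _).trans (hB x z a b)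
  by_cases hD : D x z a b = 0
  · rw [commCommDefect_apply, hD, mul_zero, mul_zero, abs_zero]
    positivity
  have hxz : l1 (x - z) ≤ ((d : ℝ) + 1) * W := by have h := l1_le_of_mem_cube (hwin x z a b hD); push_cast at h; exact h
  refine (abs_commCommDefect_le_of_weight hB hCχ hCχ' hδ hχ hχ' ρ ξ ξ' x z a b).trans ?_
  have t1 : l1 (z - p') ≤ l1 (z - x) + l1 (x - p') := l1_sub_triangle z x p'
  have t2 : l1 (x - p) ≤ l1 (x - z) + l1 (z - p) := l1_sub_triangle x z p
  rw [l1_sub_symm z x] at t1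
  have k1 : δ * l1 (z - p') ≤ δ * l1 (x - z) + δ * l1 (x - p') := by nlinarith [l1_nonneg (x - z)]
  have k2 : δ * l1 (x - p) ≤ δ * l1 (x - z) + δ * l1 (z - p) := by nlinarith [l1_nonneg (x - z)]
  have k3 : δ * l1 (x - z) ≤ δ * (((d : ℝ) + 1) * W) := mul_le_mul_of_nonneg_left hxz hδ
  set E : ℝ := Real.exp (δ * (((d : ℝ) + 1) * W)) with hE
  have f1 : Real.exp (-δ * l1 (x - p')) ≤ E * Real.exp (-δ * l1 (z - p')) := by
    rw [hE, ← Real.exp_add]; exact Real.exp_le_exp.2 (by linarith)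
  have f2 : Real.exp (-δ * l1 (z - p)) ≤ E * Real.exp (-δ * l1 (x - p)) := by
    rw [hE, ← Real.exp_add]; exact Real.exp_le_exp.2 (by linarith)
  have g1 : Real.exp (-δ * l1 (x - p')) + Real.exp (-δ * l1 (z - p')) ≤ (1 + E) * Real.exp (-δ * l1 (z - p')) := by linarith
  have g2 : Real.exp (-δ * l1 (x - p)) + Real.exp (-δ * l1 (z - p)) ≤ (1 + E) * Real.exp (-δ * l1 (x - p)) := by linarith
  have hA' : 0 ≤ |ξ'| * (Cχ' * Real.exp (δ * l1 ρ)) := by positivity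
  have hA : 0 ≤ |ξ| * (Cχ * Real.exp (δ * l1 ρ)) * B := by positivity
  have hE0 : 0 ≤ 1 + E := by positivity
  calc |ξ'| * (Cχ' * Real.exp (δ * l1 ρ)) * (Real.exp (-δ * l1 (x - p')) + Real.exp (-δ * l1 (z - p')))
        * (|ξ| * (Cχ * Real.exp (δ * l1 ρ)) * B * (Real.exp (-δ * l1 (x - p)) + Real.exp (-δ * l1 (z - p))))
      ≤ |ξ'| * (Cχ' * Real.exp (δ * l1 ρ)) * ((1 + E) * Real.exp (-δ * l1 (z - p')))
        * (|ξ| * (Cχ * Real.exp (δ * l1 ρ)) * B * ((1 + E) * Real.exp (-δ * l1 (x - p)))) :=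
        mul_le_mul (mul_le_mul_of_nonneg_left g1 hA') (mul_le_mul_of_nonneg_left g2 hA) (by positivity) (by positivity)
    _ = (|ξ'| * (Cχ' * Real.exp (δ * l1 ρ))) * (|ξ| * (Cχ * Real.exp (δ * l1 ρ)) * B) * (1 + E) ^ 2
        * (Real.exp (-δ * l1 (x - p)) * Real.exp (-δ * l1 (z - p'))) := by ring
    _ = _ := by rw [← Real.exp_add]; ring_nf

end Summit.QuantumFields.BalabanUV.Beta.D1BFx.ColumnGaugeDefectEnvelope

end
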